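import Literature.NumberTheory.IwasawaTheory.ClassicalMuVanishesCyclicAscentOddRat
import Literature.NumberTheory.NumberFields.SplitPrimesGaloisClosure
import Literature.NumberTheory.NumberFields.QuadraticRamifiedPrimesBound
import Literature.NumberTheory.EllipticCurves.ZpExtensionRestrictTower
import HarnessLib

/-!
# Iwasawa's odd-`ℓ` ascent along a cyclic degree-`p` step `K'/K` INSIDE the cyclotomic `ℤ_p`-tower over `ℚ`, with the ramification
# bound discharged: `μ_p(K·ℚ_∞/K) = 0 ⟹ μ_p(K'·ℚ_∞/K') = 0` for every number field `K` and every Galois `K'/K` of odd prime degree `p`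
# (proved; no definition, no named fact)

`Proofs`-style file (theorems only) in topic `NumberTheory/IwasawaTheory` (namespace `Literature.NumberTheory.IwasawaTheory`), written by
the prover seat `bsd-potss-rkm` g42 (cell `bsd-potss`; library pass, sequel of `ClassicalMuVanishesCyclicAscentOdd{,Rat}.lean`).

`ClassicalMuVanishesCyclicAscentOdd.lean` proves Iwasawa's Theorem 2 (1973) at odd `ℓ` for an arbitrary `ℤ_p`-tower over a base `K` under
the hypothesis «at most `T` primes of `K_n` ramify in `K'K_n` for every `n`»; `…OddRat.lean` discharges it over `K = ℚ`.  This file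
discharges it for EVERY number field `K` inside the cyclotomic tower: `κ` a cyclotomic `ℤ_p`-extension of `ℚ` (`p` odd), `K ⊆ K'` number
fields with `κ ∘ res` onto for both (linear disjointness from `ℚ_∞`), `K'/K` GALOIS OF DEGREE `p`.  Then

  **`ClassicalMuVanishes (κ|_K) ⟹ ClassicalMuVanishes (κ|_{K'})`** (`classicalMuVanishes_restrict_of_restrict_of_isGalois_of_finrank_eq_odd`).

So `μ_p = 0` climbs every tower `ℚ = K₀ ⊂ K₁ ⊂ ⋯ ⊂ K_m` of Galois steps of degree `p` (and more generally from any base with `μ_p = 0`,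
e.g. an abelian field under Ferrero–Washington, or `ℚ(ζ_p)` for a regular `p` under Iwasawa 1956): a class of number fields, in general
NON-abelian over `ℚ`, on which Iwasawa's `μ`-conjecture holds by the tree's own theorems.

PROOF.  Restrict in stages (`restrict_restrict`: `(κ|_K)|_{K'} = κ|_{K'}`) and apply the odd ascent to `κ_K = κ|_K`.  Ramification bound:
the `n`-th layer `M = (Kℚ_∞)_n` of `κ_K` and `N = j''(K')·M` (Galois over `M` of prime degree `p`, generated by `K'`); a prime `w` of `M`
ramified in `N` lies over a prime `v` of `K` ramified in `K'` (RELATIVE base change of unramifiedness, §1: an element of the inertia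
group `I(𝔔|w) ≤ Gal(N/M)` restricts to `I(𝔔 ∩ K'|v) ≤ Gal(K'/K)`, trivial), hence over a rational prime `q` ramified in `K'/ℚ`
(`e(𝔓|q) = e(𝔓|v)·e(v|q)`), i.e. `q ∣ disc K'`; and `M ≅ j(K)·ℚ_n ⊇ ℚ_n` has at most `[K:ℚ]·(q^{p−1}−1)(p−1)` primes above `q`
(`ncard_primesOver_le_finrank_mul`, `ncard_primesOver_layer_le_odd`).  `T = [K:ℚ]·∑_{q ∣ disc K'} (q^{p−1}−1)(p−1)`.

* §1 `inertia_eq_bot_of_isUnramifiedIn_relative`, **`isUnramifiedIn_of_isUnramifiedIn_relative`** (base change along `M/K` of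
  unramifiedness in a Galois `K'/K`; the relative form of the tree's `isUnramifiedIn_of_isUnramifiedIn_span`).
* §2 `ncard_primesOver_layer_restrict_le_odd` — `(Kℚ_∞)_n` has at most `[K:ℚ]·(q^{p−1}−1)(p−1)` primes above `q`, uniformly in `n`
  («every prime is finitely decomposed in the cyclotomic `ℤ_p`-extension of a number field»).
* §3 `ncard_ramified_layer_restrict_le` — the per-layer bound `T`; **`classicalMuVanishes_restrict_of_restrict_of_isGalois_of_finrank_eq_odd`**.

HONEST SCOPE.  Elementary; nothing about elliptic curves or BSD is asserted; no K9/KT row of cell `bsd-potss` consumes this file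
(library pass of seat rkm; crux M 19196 unchanged).

References: [Iwasawa1973MuInvariants] Thm. 2 (ℓ odd), §2; [Washington1997] §13.1 (finitely many primes of `K_∞` above each prime),
§13.3 Prop. 13.23; [NeukirchANT1999] Ch. I §9 Prop. (9.6) (inertia groups and ramification), Ch. III §2 Cor. (2.12) (ramified primes
divide the discriminant), Ch. III §1, proof of Prop. (1.6) (i) (transitivity of `e` and `f` in towers); [Marcus2018] Ch. 4 Thm. 31
(base change of unramifiedness).
-/

set_option autoImplicit false

noncomputable section

open scoped NumberField Classical
open NumberField Field IntermediateField IsDedekindDomain Module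

namespace Literature.NumberTheory.IwasawaTheory

open Literature.NumberTheory.EllipticCurves Literature.NumberTheory.EllipticCurves.ZpExtension
  Literature.NumberTheory.GaloisRepresentations Literature.NumberTheory.NumberFields

/-! ## §1 Relative base change of unramifiedness -/

section BaseChange

variable {K K' M N : Type*} [Field K] [NumberField K] [Field K'] [NumberField K'] [Algebra K K'] [IsGalois K K']
  [Field M] [NumberField M] [Field N] [NumberField N] [Algebra K M] [Algebra M N] [Algebra K' N] [Algebra K N]
  [IsScalarTower K M N] [IsScalarTower K K' N]

omit [NumberField K] [NumberField K'] [NumberField M] [NumberField N] in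
/-- The restriction `Gal(N/M) → Gal(K'/K)`, `σ ↦ σ|_{K'}` (`K'/K` normal, `K ⊆ M ⊆ N ⊇ K'`): a group homomorphism `r` with
`r(σ)(x) = σ(x)` on `K' ⊆ N` (Mathlib `AlgEquiv.restrictNormalHom` after restricting scalars to `K`). [folklore] -/
private theorem exists_restrictHom_relative :
    ∃ r : (N ≃ₐ[M] N) →* (K' ≃ₐ[K] K'),
      ∀ (σ : N ≃ₐ[M] N) (x : K'), algebraMap K' N (r σ x) = σ (algebraMap K' N x) :=
  ⟨{ toFun := fun σ => AlgEquiv.restrictNormalHom K' (σ.restrictScalars K)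
     map_one' := by
       have h1 : ((1 : N ≃ₐ[M] N).restrictScalars K : N ≃ₐ[K] N) = 1 := AlgEquiv.ext fun _ => rfl
       rw [h1, map_one]
     map_mul' := fun σ τ => by
       have h1 : ((σ * τ).restrictScalars K : N ≃ₐ[K] N) = σ.restrictScalars K * τ.restrictScalars K :=
         AlgEquiv.ext fun _ => rfl
       rw [h1, map_mul] },
    fun σ x => AlgEquiv.restrictNormal_commutes (σ.restrictScalars K) K' x⟩

omit [NumberField K'] in
/-- **Trivial inertia above an unramified prime** in the Galois extension `K'/K`: if the prime `v` of `K` is unramified in `K'` and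
`P ∣ v`, then `I(P|v) = 1` (`#I(P|v) = e(P|v) = 1`, Mathlib `Ideal.card_inertia_eq_ramificationIdxIn`).
[cite: NeukirchANT1999, Ch. I §9 Prop. (9.6)] -/
theorem inertia_eq_bot_of_isUnramifiedIn_relative [NumberField K'] {v : Ideal (𝓞 K)} [v.IsPrime]
    (hK : Algebra.IsUnramifiedIn (𝓞 K') v) {P : Ideal (𝓞 K')} (hP : P ∈ v.primesOver (𝓞 K')) :
    P.inertia (K' ≃ₐ[K] K') = ⊥ := by
  haveI := hP.1
  haveI := hP.2
  haveI : IsGaloisGroup (K' ≃ₐ[K] K') (𝓞 K) (𝓞 K') := IsGaloisGroup.of_isFractionRing _ _ _ K K'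
  apply Subgroup.eq_bot_of_card_eq
  rw [Ideal.card_inertia_eq_ramificationIdxIn (G := K' ≃ₐ[K] K') v P,
    Ideal.ramificationIdxIn_eq_ramificationIdx v P (K' ≃ₐ[K] K')]
  exact hK.ramificationIdx_eq_one hP.2

/-- **Relative base change of unramifiedness.**  `K'/K` Galois, `K ⊆ M ⊆ N`, `K' ⊆ N` compatibly, `N/M` Galois and generated over `M` by
the image of `K'` (`N = M·K'`).  If a prime `v` of `K` is unramified in `K'`, then every prime `w ∣ v` of `M` is unramified in `N`: for
`𝔔 ∣ w` and `σ ∈ I(𝔔|w) ≤ Gal(N/M)`, the restriction `σ|_{K'}` lies in `I(𝔔 ∩ K'|v) = 1`, so `σ` fixes `K'` and `M`, i.e. `σ = 1`.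
The relative form of the tree's `isUnramifiedIn_of_isUnramifiedIn_span` (`K = ℚ`).
[cite: Marcus2018, Ch. 4, Thm. 31] [cite: NeukirchANT1999, Ch. I §9 Prop. (9.6)] -/
theorem isUnramifiedIn_of_isUnramifiedIn_relative [IsGalois M N]
    (hgen : IntermediateField.adjoin M (Set.range (algebraMap K' N)) = ⊤)
    {v : Ideal (𝓞 K)} [v.IsPrime] (hK : Algebra.IsUnramifiedIn (𝓞 K') v)
    (w : HeightOneSpectrum (𝓞 M)) (hw : w.asIdeal.LiesOver v) :
    Algebra.IsUnramifiedIn (𝓞 N) w.asIdeal := by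
  obtain ⟨r, hr⟩ := exists_restrictHom_relative (K := K) (K' := K') (M := M) (N := N)
  refine isUnramifiedIn_of_forall_inertia_eq_bot w fun 𝔔 h𝔔 => ?_
  haveI := h𝔔.1
  haveI := h𝔔.2
  -- the prime `P = 𝔔 ∩ K'` above `v`
  set P : Ideal (𝓞 K') := 𝔔.under (𝓞 K') with hPdef
  haveI := hw
  haveI : 𝔔.LiesOver v := Ideal.LiesOver.trans 𝔔 w.asIdeal v
  haveI : P.LiesOver v := by
    rw [hPdef]
    constructor
    rw [Ideal.under_under]
    exact Ideal.LiesOver.over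
  have hPl : P ∈ v.primesOver (𝓞 K') := ⟨Ideal.IsPrime.under _ 𝔔, inferInstance⟩
  have hbot := inertia_eq_bot_of_isUnramifiedIn_relative (K := K) (K' := K') hK hPl
  -- `σ ∈ I(𝔔) ⟹ σ|_{K'} ∈ I(P) = 1 ⟹ σ = 1`
  rw [Subgroup.eq_bot_iff_forall]
  intro σ hσ
  rw [AddSubgroup.mem_inertia] at hσ
  have hmem : r σ ∈ P.inertia (K' ≃ₐ[K] K') := by
    rw [AddSubgroup.mem_inertia]
    intro y
    change algebraMap (𝓞 K') (𝓞 N) (r σ • y - y) ∈ 𝔔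
    rw [map_sub]
    have key : algebraMap (𝓞 K') (𝓞 N) (r σ • y) = σ • algebraMap (𝓞 K') (𝓞 N) y := by
      apply Subtype.ext
      change algebraMap K' N ((r σ • y : 𝓞 K') : K') = ((σ • algebraMap (𝓞 K') (𝓞 N) y : 𝓞 N) : N)
      rw [RingOfIntegers.coe_galois_smul, RingOfIntegers.coe_galois_smul, hr]
      rfl
    rw [key]
    exact hσ _
  rw [hbot, Subgroup.mem_bot] at hmem
  refine algEquiv_eq_one_of_forall_apply_algebraMap_eq hgen σ fun x => ?_
  rw [← hr, hmem]
  rfl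

end BaseChange

/-! ## §2 Finite decomposition in the cyclotomic `ℤ_p`-extension of a number field -/

variable {p : ℕ} [hp : Fact p.Prime]

/-- **`(K·ℚ_∞)_n` has at most `[K:ℚ]·(q^{p−1} − 1)(p − 1)` primes above the rational prime `q`, uniformly in `n`** (`p` odd, `κ` cyclotomic,
`κ ∘ res_{K/ℚ}` onto): the layer is `≅ j(K)·ℚ_n ⊇ ℚ_n` with `[j(K)·ℚ_n : ℚ_n] = [K:ℚ]`, and `ℚ_n` has at most `(q^{p−1}−1)(p−1)` primes above `q`
(`ncard_primesOver_layer_le_odd`). [cite: Washington1997, §13.1 (finitely many primes of `K_∞` above each prime)] -/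
theorem ncard_primesOver_layer_restrict_le_odd (hodd : p ≠ 2) {κ : ZpExtension ℚ p} (hκ : κ.IsCyclotomic)
    (K : Type) [Field K] [NumberField K] (hK : Function.Surjective (κ.toContinuousMonoidHom.comp (absGaloisRestrict ℚ K)))
    (n : ℕ) {q : ℕ} (hq : q.Prime) :
    ((Ideal.span {(q : ℤ)}).primesOver (𝓞 ↥((κ.restrict K hK).layer n))).ncard ≤
      Module.finrank ℚ K * ((q ^ (p - 1) - 1) * (p - 1)) := by
  haveI : FiniteDimensional K ↥((κ.restrict K hK).layer n) := (κ.restrict K hK).finiteDimensional_layer_holds n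
  haveI : NumberField ↥((κ.restrict K hK).layer n) := NumberField.of_module_finite K _
  haveI : FiniteDimensional ℚ ↥(κ.layer n) := κ.finiteDimensional_layer_holds n
  haveI : NumberField ↥(κ.layer n) := NumberField.of_module_finite ℚ _
  set j : K →ₐ[ℚ] AlgebraicClosure ℚ := absEmbedding ℚ K with hj
  haveI : NumberField ↥(j.fieldRange ⊔ κ.layer n) := numberField_fieldRange_sup_layer κ K j n
  letI : Algebra ↥(κ.layer n) ↥(j.fieldRange ⊔ κ.layer n) :=
    (IntermediateField.inclusion (le_sup_right : κ.layer n ≤ j.fieldRange ⊔ κ.layer n)).toRingHom.toAlgebra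
  obtain ⟨e⟩ := nonempty_ringEquiv_layer_restrict_fieldRange_sup_layer κ K hK j n
  rw [ncard_primesOver_eq_of_ringEquiv e q]
  calc ((Ideal.span {(q : ℤ)}).primesOver (𝓞 ↥(j.fieldRange ⊔ κ.layer n))).ncard
      ≤ Module.finrank ↥(κ.layer n) ↥(j.fieldRange ⊔ κ.layer n) *
          ((Ideal.span {(q : ℤ)}).primesOver (𝓞 ↥(κ.layer n))).ncard :=
        ncard_primesOver_le_finrank_mul ↥(κ.layer n) ↥(j.fieldRange ⊔ κ.layer n) hq
    _ ≤ Module.finrank ℚ K * ((q ^ (p - 1) - 1) * (p - 1)) := by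
        have hfr : Module.finrank ↥(κ.layer n) ↥(j.fieldRange ⊔ κ.layer n) = Module.finrank ℚ K :=
          finrank_layer_fieldRange_sup_layer κ K hK j n
        exact Nat.mul_le_mul hfr.le (ncard_primesOver_layer_le_odd hodd hκ n hq)

/-- The rational prime under a maximal ideal of a ring of integers. [folklore] -/
private theorem exists_ratPrime_liesOver {L : Type*} [Field L] [NumberField L] (P : Ideal (𝓞 L)) [P.IsMaximal] :
    ∃ q : ℕ, q.Prime ∧ P.LiesOver (Ideal.span {(q : ℤ)}) := by
  have hP0 : P ≠ ⊥ := Ring.ne_bot_of_isMaximal_of_not_isField ‹_› (RingOfIntegers.not_isField L)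
  haveI : (P.under ℤ).IsPrime := Ideal.IsPrime.under ℤ P
  have hPZ0 : P.under ℤ ≠ ⊥ := mt Ideal.eq_bot_of_comap_eq_bot hP0
  set g := Submodule.IsPrincipal.generator (P.under ℤ) with hgdef
  have hg : Ideal.span {g} = P.under ℤ := Ideal.span_singleton_generator (P.under ℤ)
  have hg0 : g ≠ 0 := fun h => hPZ0 (by rw [← hg, h, Ideal.span_singleton_eq_bot])
  have hgprime : Prime g := (Ideal.span_singleton_prime hg0).mp (hg.symm ▸ inferInstance)
  refine ⟨g.natAbs, Int.prime_iff_natAbs_prime.mp hgprime, ⟨?_⟩⟩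
  rw [Int.span_natAbs, hg]

/-! ## §3 The ramification bound and the ascent -/

/-- **At most `T = [K:ℚ]·∑_{q ∣ disc K'} (q^{p−1} − 1)(p − 1)` primes of `(Kℚ_∞)_n` ramify in `j''(K')·(Kℚ_∞)_n`, for every `n`** (`p` odd,
`κ` cyclotomic, `K'/K` Galois of degree `p`, `κ ∘ res` onto for `K` and `K'`): `N = j''(K')·M` is Galois over `M = (Kℚ_∞)_n` of prime degree
`p`, hence generated by `K'`; a ramified `w` lies over a prime `v` of `K` ramified in `K'` (§1), `v` over a rational `q` ramified in `K'/ℚ`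
(`e(𝔓|q) = e(𝔓|v)·e(v|q)`), so `q ∣ disc K'`; and §2 counts the `w` above `q`.
[cite: NeukirchANT1999, Ch. III §2 Cor. (2.12) (ramified primes divide the discriminant)] [cite: Marcus2018, Ch. 4 Thm. 31] [cite: Washington1997, §13.1] -/
theorem ncard_ramified_layer_restrict_le (hodd : p ≠ 2) {κ : ZpExtension ℚ p} (hκ : κ.IsCyclotomic)
    (K K' : Type) [Field K] [NumberField K] [Field K'] [NumberField K'] [Algebra K K'] [IsGalois K K']
    (hdeg : Module.finrank K K' = p)
    (hK : Function.Surjective (κ.toContinuousMonoidHom.comp (absGaloisRestrict ℚ K)))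
    (hKK' : Function.Surjective ((κ.restrict K hK).toContinuousMonoidHom.comp (absGaloisRestrict K K')))
    (j'' : K' →ₐ[K] AlgebraicClosure K) (n : ℕ) :
    letI : Algebra ↥((κ.restrict K hK).layer n) ↥(j''.fieldRange ⊔ (κ.restrict K hK).layer n) :=
      (IntermediateField.inclusion (le_sup_right : (κ.restrict K hK).layer n ≤ j''.fieldRange ⊔ (κ.restrict K hK).layer n)).toRingHom.toAlgebra
    {w : HeightOneSpectrum (𝓞 ↥((κ.restrict K hK).layer n)) |
        w.asIdeal.ramificationIdxIn (𝓞 ↥(j''.fieldRange ⊔ (κ.restrict K hK).layer n)) ≠ 1}.ncard ≤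
      Module.finrank ℚ K * ∑ q ∈ (NumberField.discr K').natAbs.primeFactors, (q ^ (p - 1) - 1) * (p - 1) := by
  classical
  have hpp : p.Prime := hp.out
  set κK := κ.restrict K hK with hκK
  haveI : FiniteDimensional K K' := Module.Finite.of_restrictScalars_finite ℚ K K'
  haveI : FiniteDimensional K ↥(κK.layer n) := κK.finiteDimensional_layer_holds n
  haveI : NumberField ↥(κK.layer n) := NumberField.of_module_finite K _
  haveI : NumberField ↥(j''.fieldRange ⊔ κK.layer n) := numberField_fieldRange_sup_layer κK K' j'' n
  have hle : κK.layer n ≤ j''.fieldRange ⊔ κK.layer n := le_sup_right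
  letI algL : Algebra ↥(κK.layer n) ↥(j''.fieldRange ⊔ κK.layer n) := (IntermediateField.inclusion hle).toRingHom.toAlgebra
  haveI : IsScalarTower K ↥(κK.layer n) ↥(j''.fieldRange ⊔ κK.layer n) := IsScalarTower.of_algebraMap_eq fun _ => rfl
  let eK : K' →+* ↥(j''.fieldRange ⊔ κK.layer n) :=
    (j'' : K' →+* AlgebraicClosure K).codRestrict (j''.fieldRange ⊔ κK.layer n) fun x =>
      (le_sup_left : j''.fieldRange ≤ j''.fieldRange ⊔ κK.layer n) (j''.mem_fieldRange.mpr ⟨x, rfl⟩)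
  letI algK : Algebra K' ↥(j''.fieldRange ⊔ κK.layer n) := eK.toAlgebra
  haveI : IsScalarTower K K' ↥(j''.fieldRange ⊔ κK.layer n) :=
    IsScalarTower.of_algebraMap_eq fun x => Subtype.ext (j''.commutes x).symm
  haveI : Module.Free ↥(κK.layer n) ↥(j''.fieldRange ⊔ κK.layer n) := Module.Free.of_divisionRing _ _
  haveI : FiniteDimensional ↥(κK.layer n) ↥(j''.fieldRange ⊔ κK.layer n) :=
    Module.Finite.of_restrictScalars_finite K ↥(κK.layer n) ↥(j''.fieldRange ⊔ κK.layer n)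
  -- `[N : M] = p`, `N/M` Galois
  have hdegL : Module.finrank ↥(κK.layer n) ↥(j''.fieldRange ⊔ κK.layer n) = p :=
    (finrank_layer_fieldRange_sup_layer κK K' hKK' j'' n).trans hdeg
  haveI : IsGalois ↥(κK.layer n) ↥(j''.fieldRange ⊔ κK.layer n) := isGalois_layer_fieldRange_sup_layer κK K' j'' n
  haveI : IsGaloisGroup (↥(j''.fieldRange ⊔ κK.layer n) ≃ₐ[↥(κK.layer n)] ↥(j''.fieldRange ⊔ κK.layer n)) (𝓞 ↥(κK.layer n))
      (𝓞 ↥(j''.fieldRange ⊔ κK.layer n)) :=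
    IsGaloisGroup.of_isFractionRing _ _ _ (↥(κK.layer n)) ↥(j''.fieldRange ⊔ κK.layer n)
  -- `N` is generated over `M` by the image of `K'`
  have hgen : IntermediateField.adjoin (↥(κK.layer n)) (Set.range (algebraMap K' ↥(j''.fieldRange ⊔ κK.layer n))) = ⊤ := by
    set E := IntermediateField.adjoin (↥(κK.layer n)) (Set.range (algebraMap K' ↥(j''.fieldRange ⊔ κK.layer n))) with hE
    have h2 : (Module.finrank (↥(κK.layer n)) ↥(j''.fieldRange ⊔ κK.layer n)).Prime := by rw [hdegL]; exact hpp
    haveI := IntermediateField.isSimpleOrder_of_finrank_prime (↥(κK.layer n)) ↥(j''.fieldRange ⊔ κK.layer n) h2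
    rcases eq_bot_or_eq_top E with h | h
    · exfalso
      have hsub : j''.fieldRange ≤ κK.layer n := by
        rintro _ ⟨x, rfl⟩
        have hx : algebraMap K' ↥(j''.fieldRange ⊔ κK.layer n) x ∈
            (⊥ : IntermediateField ↥(κK.layer n) ↥(j''.fieldRange ⊔ κK.layer n)) :=
          h ▸ IntermediateField.subset_adjoin _ _ ⟨x, rfl⟩
        obtain ⟨y, hy⟩ := IntermediateField.mem_bot.mp hx
        have hy' : ((y : ↥(κK.layer n)) : AlgebraicClosure K) = j'' x :=
          congrArg (fun z : ↥(j''.fieldRange ⊔ κK.layer n) => (z : AlgebraicClosure K)) hy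
        exact hy' ▸ y.2
      have heq : j''.fieldRange ⊔ κK.layer n = κK.layer n := sup_eq_right.mpr hsub
      have h1 : Module.finrank K ↥(j''.fieldRange ⊔ κK.layer n) = Module.finrank K K' * p ^ n :=
        finrank_fieldRange_sup_layer κK K' hKK' j'' n
      have h2' : Module.finrank K ↥(j''.fieldRange ⊔ κK.layer n) = p ^ n := by
        rw [(IntermediateField.equivOfEq heq).toLinearEquiv.finrank_eq]; exact κK.finrank_layer_holds n
      rw [h2', hdeg] at h1
      have : p ^ n * 1 = p ^ n * p := by rw [mul_one, mul_comm]; exact h1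
      exact hpp.one_lt.ne (Nat.eq_of_mul_eq_mul_left (pow_pos hpp.pos n) this)
    · exact h
  -- every ramified prime of `M` lies over a prime factor of `disc K'`
  set P := (NumberField.discr K').natAbs.primeFactors with hP
  have hdisc : NumberField.discr K' ≠ 0 := NumberField.discr_ne_zero K'
  have hcover : {w : HeightOneSpectrum (𝓞 ↥(κK.layer n)) |
      w.asIdeal.ramificationIdxIn (𝓞 ↥(j''.fieldRange ⊔ κK.layer n)) ≠ 1} ⊆
      ⋃ q ∈ P, {w : HeightOneSpectrum (𝓞 ↥(κK.layer n)) | w.asIdeal ∈ (Ideal.span {(q : ℤ)}).primesOver (𝓞 ↥(κK.layer n))} := by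
    intro w hw
    haveI := w.isPrime
    obtain ⟨⟨Q, hQ, hQw⟩⟩ := w.asIdeal.nonempty_primesOver (S := 𝓞 ↥(j''.fieldRange ⊔ κK.layer n))
    haveI := hQ; haveI := hQw
    have hnot : ¬ Algebra.IsUnramifiedIn (𝓞 ↥(j''.fieldRange ⊔ κK.layer n)) w.asIdeal := fun hunr =>
      hw ((Ideal.ramificationIdxIn_eq_ramificationIdx w.asIdeal Q
        (↥(j''.fieldRange ⊔ κK.layer n) ≃ₐ[↥(κK.layer n)] ↥(j''.fieldRange ⊔ κK.layer n))).trans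
          (hunr.ramificationIdx_eq_one hQw))
    -- the rational prime `q` below `w` and the prime `v = w ∩ K` of `K`
    haveI : w.asIdeal.IsMaximal := w.isPrime.isMaximal w.ne_bot
    obtain ⟨q, hq, hwq⟩ := exists_ratPrime_liesOver w.asIdeal
    haveI := hwq; haveI : Fact q.Prime := ⟨hq⟩
    set v : Ideal (𝓞 K) := w.asIdeal.under (𝓞 K) with hvdef
    haveI : v.IsPrime := Ideal.IsPrime.under _ w.asIdeal
    have hwv : w.asIdeal.LiesOver v := ⟨rfl⟩
    haveI := hwv
    haveI hvq : v.LiesOver (Ideal.span {(q : ℤ)}) := Ideal.LiesOver.tower_bot w.asIdeal v (Ideal.span {(q : ℤ)})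
    -- `v` ramifies in `K'` (relative base change, §1)
    have hKv : ¬ Algebra.IsUnramifiedIn (𝓞 K') v := fun hunr =>
      hnot (isUnramifiedIn_of_isUnramifiedIn_relative (K := K) (K' := K') hgen hunr w hwv)
    -- hence `q` ramifies in `K'/ℚ` (`e(𝔓|v) ∣ e(𝔓|q)`)
    have hqK : ¬ Algebra.IsUnramifiedIn (𝓞 K') (Ideal.span {(q : ℤ)}) := by
      intro hq_unr
      apply hKv
      rw [Algebra.isUnramifiedIn_iff_forall_ramificationIdx_eq_one]
      intro P' _ hP'v
      haveI := hP'v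
      have hP'q : P'.LiesOver (Ideal.span {(q : ℤ)}) := Ideal.LiesOver.trans P' v (Ideal.span {(q : ℤ)})
      have h1 : P'.ramificationIdx ℤ = 1 := hq_unr.ramificationIdx_eq_one hP'q
      have hdvd : P'.ramificationIdx (𝓞 K) ∣ P'.ramificationIdx ℤ := Ideal.ramificationIdx_above_dvd v P'
      rw [h1] at hdvd
      exact Nat.dvd_one.mp hdvd
    have hqd : (q : ℤ) ∣ NumberField.discr K' := by
      by_contra hnd
      exact hqK ((NumberField.not_dvd_discr_iff_isUnramifiedIn K' (𝓞 K') (Nat.prime_iff_prime_int.mp hq)).mp hnd)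
    refine Set.mem_biUnion (x := q) ?_ ?_
    · exact Nat.mem_primeFactors.mpr ⟨hq, Int.natAbs_dvd_natAbs.mpr hqd |>.trans (by simp), Int.natAbs_ne_zero.mpr hdisc⟩
    · exact ⟨w.isPrime, hwq⟩
  have hfin : ∀ q ∈ P,
      ({w : HeightOneSpectrum (𝓞 ↥(κK.layer n)) | w.asIdeal ∈ (Ideal.span {(q : ℤ)}).primesOver (𝓞 ↥(κK.layer n))}).Finite ∧
      ({w : HeightOneSpectrum (𝓞 ↥(κK.layer n)) | w.asIdeal ∈ (Ideal.span {(q : ℤ)}).primesOver (𝓞 ↥(κK.layer n))}).ncard ≤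
        Module.finrank ℚ K * ((q ^ (p - 1) - 1) * (p - 1)) := by
    intro q hq
    have hqp : q.Prime := Nat.prime_of_mem_primeFactors hq
    haveI : Fact q.Prime := ⟨hqp⟩
    haveI : (Ideal.span {(q : ℤ)}).IsMaximal := Int.ideal_span_isMaximal_of_prime q
    have hinj : Set.InjOn (fun w : HeightOneSpectrum (𝓞 ↥(κK.layer n)) => w.asIdeal)
        {w | w.asIdeal ∈ (Ideal.span {(q : ℤ)}).primesOver (𝓞 ↥(κK.layer n))} := fun w _ w' _ h => HeightOneSpectrum.ext h
    have hmaps : Set.MapsTo (fun w : HeightOneSpectrum (𝓞 ↥(κK.layer n)) => w.asIdeal)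
        {w | w.asIdeal ∈ (Ideal.span {(q : ℤ)}).primesOver (𝓞 ↥(κK.layer n))}
        ((Ideal.span {(q : ℤ)}).primesOver (𝓞 ↥(κK.layer n))) := fun w hw => hw
    have hfinT : ((Ideal.span {(q : ℤ)}).primesOver (𝓞 ↥(κK.layer n))).Finite := IsDedekindDomain.primesOver_finite _ _
    refine ⟨Set.Finite.of_injOn hmaps hinj hfinT, ?_⟩
    calc ({w : HeightOneSpectrum (𝓞 ↥(κK.layer n)) | w.asIdeal ∈ (Ideal.span {(q : ℤ)}).primesOver (𝓞 ↥(κK.layer n))}).ncard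
        ≤ ((Ideal.span {(q : ℤ)}).primesOver (𝓞 ↥(κK.layer n))).ncard := Set.ncard_le_ncard_of_injOn _ hmaps hinj hfinT
      _ ≤ Module.finrank ℚ K * ((q ^ (p - 1) - 1) * (p - 1)) := ncard_primesOver_layer_restrict_le_odd hodd hκ K hK n hqp
  calc {w : HeightOneSpectrum (𝓞 ↥(κK.layer n)) | w.asIdeal.ramificationIdxIn (𝓞 ↥(j''.fieldRange ⊔ κK.layer n)) ≠ 1}.ncard
      ≤ (⋃ q ∈ P, {w : HeightOneSpectrum (𝓞 ↥(κK.layer n)) |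
          w.asIdeal ∈ (Ideal.span {(q : ℤ)}).primesOver (𝓞 ↥(κK.layer n))}).ncard :=
        Set.ncard_le_ncard hcover (Set.Finite.biUnion P.finite_toSet fun q hq => (hfin q hq).1)
    _ ≤ ∑ q ∈ P, ({w : HeightOneSpectrum (𝓞 ↥(κK.layer n)) |
          w.asIdeal ∈ (Ideal.span {(q : ℤ)}).primesOver (𝓞 ↥(κK.layer n))}).ncard := Finset.set_ncard_biUnion_le P _
    _ ≤ ∑ q ∈ P, Module.finrank ℚ K * ((q ^ (p - 1) - 1) * (p - 1)) := Finset.sum_le_sum fun q hq => (hfin q hq).2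
    _ = Module.finrank ℚ K * ∑ q ∈ P, (q ^ (p - 1) - 1) * (p - 1) := by rw [Finset.mul_sum]

/-- **Iwasawa's odd-`ℓ` ascent inside the cyclotomic tower, ramification bound discharged.**  `p` odd, `κ` a cyclotomic `ℤ_p`-extension of
`ℚ`, `K ⊆ K'` number fields with `κ ∘ res` onto for both, `K'/K` Galois of degree `p`:
`ClassicalMuVanishes (κ|_K) ⟹ ClassicalMuVanishes (κ|_{K'})`, i.e. `μ_p(K·ℚ_∞/K) = 0 ⟹ μ_p(K'·ℚ_∞/K') = 0` in growth form — restriction in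
stages (`restrict_restrict`) + `classicalMuVanishes_restrict_of_isGalois_of_finrank_eq_of_odd` over the base `K` + the bound
`ncard_ramified_layer_restrict_le`. [cite: Iwasawa1973MuInvariants, Thm. 2 (ℓ odd)] [cite: Washington1997, §13.1, §13.3 Prop. 13.23] -/
theorem classicalMuVanishes_restrict_of_restrict_of_isGalois_of_finrank_eq_odd (hodd : p ≠ 2) {κ : ZpExtension ℚ p}
    (hκ : κ.IsCyclotomic) (K K' : Type) [Field K] [NumberField K] [Field K'] [NumberField K'] [Algebra K K']
    [IsScalarTower ℚ K K'] [IsGalois K K'] (hdeg : Module.finrank K K' = p)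
    (hK : Function.Surjective (κ.toContinuousMonoidHom.comp (absGaloisRestrict ℚ K)))
    (hK' : Function.Surjective (κ.toContinuousMonoidHom.comp (absGaloisRestrict ℚ K')))
    (hμ : ClassicalMuVanishes (κ.restrict K hK)) :
    ClassicalMuVanishes (κ.restrict K' hK') := by
  have hKK' : Function.Surjective ((κ.restrict K hK).toContinuousMonoidHom.comp (absGaloisRestrict K K')) :=
    (surjective_comp_absGaloisRestrict_tower_iff κ K K' hK).mpr hK'
  have h := classicalMuVanishes_restrict_of_isGalois_of_finrank_eq_of_odd hodd (κ.restrict K hK) K' hdeg hKK'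
    (absEmbedding K K') _ (ncard_ramified_layer_restrict_le hodd hκ K K' hdeg hK hKK' (absEmbedding K K')) hμ
  rwa [restrict_restrict κ K K' hK hKK' hK'] at h

end Literature.NumberTheory.IwasawaTheory

end
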